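import Literature.NumberTheory.GaloisRepresentations.ContinuousShapiroLiftFunctor
import Literature.NumberTheory.GaloisRepresentations.ContinuousH1AddHomAlgebraProofs
import Literature.NumberTheory.GaloisRepresentations.ContinuousCohomologyConnecting
import HarnessLib

/-!
# GLUE package T2 (b): restrict-then-change-coefficients on `H¹` — `H¹(f|_H) ∘ res_{H ≤ H'}` — for an ABSTRACT `TopRep`, and its calculus
# (the kernel-cheap carrier of every cocycle-level identity of the `(n, k)`-system `H¹(U_{n,w}, A_ρ[2^k]|)` of line «onepair»)

Route `ResidualThetaTransportAtTwo` (RTT), crux RSL_g `ResidualSignedLambdaLowerCMAtTwo` (stmt-BirchSwinnertonDyer-22608), line «onepair»; LEAD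
`prover-bsd-wall-rtt-p2` g19 (`--supports 22608 --as helper`, closes nothing). THEOREMS ONLY about the tree's `cohomologyMap`, `subgroupRepMap`,
`resLe` (no definition, no named fact, no instance, no notation, no `sorry`). BSD is not proved by any of this; RSL_g (22608) stays OPEN.

WHY A SEPARATE, GENERIC FILE (kernel discipline). The maps `OnePair.jAway w n k` (`…AwayDefs`) and the transitions `OnePair.tAway` of the
directed `(n, k)`-system (`…AwayKernelTransitions`) all have the shape `H¹(f|_H) ∘ res_{H ≤ H'} : H¹(H', X) → H¹(H, Y)`. At the concrete modules
`A_ρ[2^k]|_{U_{n,w}}` a `rfl` between cocycle values living on two different layers `U_n`, `U_m` makes the kernel unfold `ZpExtension.layerSubgroup`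
(deterministic timeouts in the g18/g19 logs); stated ONCE for an abstract `TopRep X` over an abstract topological group with subgroups
`H ≤ H' ≤ H''` as variables, the same identities are definitional and cheap (the idiom of `Kato2004.resLe_oneCocycleClass_eq_of_forall_apply` /
`exists_resLe_oneCocycleClass_eq`). The sequel only instantiates and rewrites with pointwise value lemmas.

* `AwayKernel.cohomologyMap_oneCocycleClass_eq_of_forall_apply` — `H¹(f)[φ] = [ψ]` from `f ∘ φ = ψ` pointwise;
* `…cohomologyMap_resLe_oneCocycleClass_eq_of_forall_apply`, `…exists_cohomologyMap_resLe_oneCocycleClass_eq` (existential explicit form);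
* `…cohomologyMap_resLe_cohomologyMap_resLe_of_forall_apply` (composition under a pointwise factorisation `g ∘ f = gf`),
  `…cohomologyMap_subgroupRepMap_id_apply`, `…cohomologyMap_subgroupRepMap_congr`, `…resLe_cohomologyMap_subgroupRepMap` (naturality of `res`
  in the coefficients);
* `…cohomologyMap_resLe_oneCocycleClass_eq_zero_of_forall_apply` (vanishing from a coboundary witness read through an injective `ι : Y ⟶ Z`),
  `…exists_of_cohomologyMap_resLe_oneCocycleClass_eq_zero` (the witness of a class that dies, read on the values `f (d g)`).

References: [SerreGaloisCohomology1997] I §2.2, §2.4; [NeukirchSchmidtWingberg2008] I §5.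
-/

set_option autoImplicit false
-- the Theorems namespace of this sub repeats the summit name by design (D-0017 nested layout)
set_option linter.dupNamespace false

noncomputable section

open CategoryTheory Topology
open Literature.NumberTheory.GaloisRepresentations Literature.NumberTheory.EllipticCurves

universe v

namespace Summit.BirchSwinnertonDyer.BirchSwinnertonDyer.Theorems.ThetaTransport.AwayKernel

section ResMap

variable {R : Type*} [CommRing R] [TopologicalSpace R] {G : Type v} [Group G] [TopologicalSpace G] [IsTopologicalGroup G]
  {X Y Z : TopRep.{v} R G}

/-- **`H¹(f)[φ] = [ψ]` from `f ∘ φ = ψ` pointwise** (Serre I §2.4 `H¹(f)[φ] = [f ∘ φ]`, the tree's `cohomologyMap_oneCocycleClass`, in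
extensionality form). [cite: SerreGaloisCohomology1997, I §2.4] -/
theorem cohomologyMap_oneCocycleClass_eq_of_forall_apply (f : X ⟶ Y) (φ : contOneCocycles X) (ψ : contOneCocycles Y)
    (h : ∀ g : G, f.hom (φ.1 g) = ψ.1 g) : cohomologyMap f 1 (oneCocycleClass X φ) = oneCocycleClass Y ψ := by
  rw [cohomologyMap_oneCocycleClass]
  congr 1
  exact Subtype.ext (ContinuousMap.ext fun g ↦ (pullback_id_resIdHom_apply f φ g).trans (h g))

/-- **`H¹(f|_H) (res_{H ≤ H'} [d]) = [c]` from `f ∘ d|_H = c` pointwise.** [cite: SerreGaloisCohomology1997, I §2.4] -/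
theorem cohomologyMap_resLe_oneCocycleClass_eq_of_forall_apply (f : X ⟶ Y) {H H' : Subgroup G} (hle : H ≤ H')
    (d : contOneCocycles (subgroupRep X H')) (c : contOneCocycles (subgroupRep Y H))
    (hdc : ∀ g : ↥H, f.hom (d.1 (subgroupInclusion hle g)) = c.1 g) :
    cohomologyMap (subgroupRepMap f H) 1 (resLe X hle 1 (oneCocycleClass _ d)) = oneCocycleClass _ c := by
  rw [resLe_oneCocycleClass]
  exact cohomologyMap_oneCocycleClass_eq_of_forall_apply _ _ _ hdc

/-- **`H¹(f|_H) (res [d])` is the class of SOME cocycle with the expected values** `c g = f (d g)` (existential form, the kernel-light idiom of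
`exists_resLe_oneCocycleClass_eq`). [cite: SerreGaloisCohomology1997, I §2.4] -/
theorem exists_cohomologyMap_resLe_oneCocycleClass_eq (f : X ⟶ Y) {H H' : Subgroup G} (hle : H ≤ H')
    (d : contOneCocycles (subgroupRep X H')) :
    ∃ c : contOneCocycles (subgroupRep Y H), (∀ g : ↥H, c.1 g = f.hom (d.1 (subgroupInclusion hle g))) ∧
      cohomologyMap (subgroupRepMap f H) 1 (resLe X hle 1 (oneCocycleClass _ d)) = oneCocycleClass _ c := by
  obtain ⟨ψ, hψ, hres⟩ := exists_resLe_oneCocycleClass_eq X hle d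
  refine ⟨contOneCocycles.pullback (ContinuousMonoidHom.id _) (resIdHom (subgroupRepMap f H)) ψ, fun g ↦ ?_, ?_⟩
  · rw [pullback_id_resIdHom_apply, subgroupRepMap_apply, hψ]
    rfl
  · rw [hres, cohomologyMap_oneCocycleClass]

/-- **Composition**: `(H¹(g|) ∘ res_h) ∘ (H¹(f|) ∘ res_{h'}) = H¹(gf|) ∘ res_{h'h}` whenever `g ∘ f = gf` pointwise.
[cite: SerreGaloisCohomology1997, I §2.4] -/
theorem cohomologyMap_resLe_cohomologyMap_resLe_of_forall_apply (f : X ⟶ Y) (g : Y ⟶ Z) (gf : X ⟶ Z)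
    (hfac : ∀ x : X, g.hom (f.hom x) = gf.hom x) {H H' H'' : Subgroup G} (h : H ≤ H') (h' : H' ≤ H'')
    (y : continuousCohomology 1 (subgroupRep X H'')) :
    cohomologyMap (subgroupRepMap g H) 1 (resLe Y h 1 (cohomologyMap (subgroupRepMap f H') 1 (resLe X h' 1 y))) =
      cohomologyMap (subgroupRepMap gf H) 1 (resLe X (h.trans h') 1 y) := by
  obtain ⟨d, rfl⟩ := oneCocycleClass_surjective _ y
  obtain ⟨c, hc, hres⟩ := exists_cohomologyMap_resLe_oneCocycleClass_eq f h' d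
  obtain ⟨c', hc', hres'⟩ := exists_cohomologyMap_resLe_oneCocycleClass_eq gf (h.trans h') d
  rw [hres, hres']
  refine cohomologyMap_resLe_oneCocycleClass_eq_of_forall_apply g h c c' fun x ↦ ?_
  rw [hc, hc', hfac]
  rfl

/-- `H¹(𝟙|_H)` is the identity. [cite: SerreGaloisCohomology1997, I §2.4] -/
theorem cohomologyMap_subgroupRepMap_id_apply {H : Subgroup G} (y : continuousCohomology 1 (subgroupRep X H)) :
    cohomologyMap (subgroupRepMap (𝟙 X) H) 1 y = y := by
  obtain ⟨d, rfl⟩ := oneCocycleClass_surjective _ y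
  exact cohomologyMap_oneCocycleClass_eq_of_forall_apply _ d d fun _ ↦ rfl

/-- `H¹(f|_H)` only depends on the values of `f`. [cite: SerreGaloisCohomology1997, I §2.4] -/
theorem cohomologyMap_subgroupRepMap_congr {f f' : X ⟶ Y} (hff' : ∀ x : X, f.hom x = f'.hom x) {H : Subgroup G}
    (y : continuousCohomology 1 (subgroupRep X H)) :
    cohomologyMap (subgroupRepMap f H) 1 y = cohomologyMap (subgroupRepMap f' H) 1 y := by
  obtain ⟨d, rfl⟩ := oneCocycleClass_surjective _ y
  rw [cohomologyMap_oneCocycleClass (subgroupRepMap f' H)]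
  exact cohomologyMap_oneCocycleClass_eq_of_forall_apply _ d _ fun g ↦
    (hff' _).trans (pullback_id_resIdHom_apply (subgroupRepMap f' H) d g).symm

/-- **Naturality of restriction in the coefficients**: `res_{H ≤ H'} ∘ H¹(f|_{H'}) = H¹(f|_H) ∘ res_{H ≤ H'}`.
[cite: SerreGaloisCohomology1997, I §2.4] -/
theorem resLe_cohomologyMap_subgroupRepMap (f : X ⟶ Y) {H H' : Subgroup G} (h : H ≤ H') (y : continuousCohomology 1 (subgroupRep X H')) :
    resLe Y h 1 (cohomologyMap (subgroupRepMap f H') 1 y) = cohomologyMap (subgroupRepMap f H) 1 (resLe X h 1 y) := by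
  have h1 := cohomologyMap_resLe_cohomologyMap_resLe_of_forall_apply f (𝟙 Y) f (fun _ ↦ rfl) h (le_refl H') y
  rw [resLe_refl_apply, cohomologyMap_subgroupRepMap_id_apply] at h1
  exact h1

/-- **Vanishing from a coboundary witness read through an injective morphism `ι : Y ⟶ Z`**: if `ι (f (d g)) = g • ι v - ι v` on `H`, then
`H¹(f|_H) (res [d]) = 0`. [cite: SerreGaloisCohomology1997, I §2.2] -/
theorem cohomologyMap_resLe_oneCocycleClass_eq_zero_of_forall_apply (f : X ⟶ Y) (ι : Y ⟶ Z) (hinj : Function.Injective ι.hom)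
    {H H' : Subgroup G} (hle : H ≤ H') (d : contOneCocycles (subgroupRep X H')) (v : Y)
    (hv : ∀ g : ↥H, ι.hom (f.hom (d.1 (subgroupInclusion hle g))) = Z.ρ (g : G) (ι.hom v) - ι.hom v) :
    cohomologyMap (subgroupRepMap f H) 1 (resLe X hle 1 (oneCocycleClass _ d)) = 0 := by
  obtain ⟨c, hc, hres⟩ := exists_cohomologyMap_resLe_oneCocycleClass_eq f hle d
  rw [hres, oneCocycleClass_eq_zero_iff]
  refine ⟨v, fun g ↦ hinj ?_⟩
  rw [hc, hv, map_sub, subgroupRep_ρ_apply, TopRep.hom_comm_apply]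

/-- **The coboundary witness of a class killed by `H¹(f|_H) ∘ res`**, read on the values `f (d g)`. [cite: SerreGaloisCohomology1997, I §2.2] -/
theorem exists_of_cohomologyMap_resLe_oneCocycleClass_eq_zero (f : X ⟶ Y) {H H' : Subgroup G} (hle : H ≤ H')
    (d : contOneCocycles (subgroupRep X H')) (h0 : cohomologyMap (subgroupRepMap f H) 1 (resLe X hle 1 (oneCocycleClass _ d)) = 0) :
    ∃ v : Y, ∀ g : ↥H, f.hom (d.1 (subgroupInclusion hle g)) = Y.ρ (g : G) v - v := by
  obtain ⟨c, hc, hres⟩ := exists_cohomologyMap_resLe_oneCocycleClass_eq f hle d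
  rw [hres, oneCocycleClass_eq_zero_iff] at h0
  obtain ⟨v, hv⟩ := h0
  exact ⟨v, fun g ↦ (hc g).symm.trans (hv g)⟩

end ResMap

end Summit.BirchSwinnertonDyer.BirchSwinnertonDyer.Theorems.ThetaTransport.AwayKernel

end
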